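import Summits.BirchSwinnertonDyer.BirchSwinnertonDyer.Theorems.ResidualThetaTransportAtTwoResidualSignedLambdaLowerCMAtTwoEntryOfFinrank
import Summits.BirchSwinnertonDyer.BirchSwinnertonDyer.Theorems.ResidualThetaTransportAtTwoResidualSignedLambdaLowerCMAtTwoIntDescent
import Summits.BirchSwinnertonDyer.BirchSwinnertonDyer.Theorems.ResidualThetaTransportAtTwoResidualSignedLambdaLowerCMAtTwoDualityGlue
import Summits.BirchSwinnertonDyer.BirchSwinnertonDyer.Theorems.ResidualThetaTransportAtTwoResidualSignedLambdaLowerCMAtTwoDualGenerator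
import HarnessLib

/-!
# RSL_g ⟸ ONE duality datum in MIXED ℤ₂/𝒪-currency (the `_of` entry of skeleton v2 `onepair`): compact side over `ℤ₂`, Kato side over `𝒪`

Route `ResidualThetaTransportAtTwo` (RTT), crux RSL_g `ResidualSignedLambdaLowerCMAtTwo` (stmt-BirchSwinnertonDyer-22608); seat `prover-bsd-wall-rtt-p2` g17
(`--supports`, closes nothing). THEOREMS ONLY. RSL_g is NOT proved here (the duality datum `hdata` is the hypothesis); BSD is not proved by any of this.

WHAT. `LambdaLowerBoundO.cmLambdaLower_of_dualityData_onePair` (p673478) takes the one-pair duality datum with EVERY module over `𝒪` and every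
count in `Frac 𝒪`-currency. In the v2 cut of the 22608 line (SKELETON-V2-CUT-g16 (C1)/(C3)) the compact local side
`P ⊇ Hom((Fin r → E(ℚ_{∞,v})), ℤ₂)` (through the transport `Θ`) is a `ℤ₂`-module ONLY, while Kato's `𝐇¹_Γ(T_ρ) = I.H`, the zeta span `Z`, the flank
`H2` and the Selmer modules `Sg ⊇ Sel₀` are `𝒪`-modules. **`cmLambdaLower_of_intDualityData`** is the entry in exactly that mixed currency, with
NO instance beyond the crux's own (`ℤ₂` acts through `padicIntToCoeffIntegers`, written out as equations): `pair : P →+ Sg⋆` additive with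
`pair (z•t) s = pair t (ι z • s)`, `locd : H →+ P` with `locd (ι z • x) = z • locd x`, (EH_Z), (ORTH), (DH) with a `ℤ₂`-scalar, the compact count
`f·(d + Σ + e) ≤ dim_{ℚ₂}(ℚ₂ ⊗_{ℤ₂} P ⧸ span (locd Z))` with `f = rank_{ℤ₂} 𝒪` witnessed by an additive basis `B : ℤ₂^f ≃+ 𝒪`, and the two flanks
`λ_𝒪(H/Z) ≤ λ_𝒪(H2) + e`, `λ_𝒪(H2) ≤ λ_𝒪(Sel₀⋆)` in `Frac 𝒪`-currency. Proof: install `Algebra ℤ₂ 𝒪 := ι.toAlgebra` (faithful, finite free of rank `f`,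
hence algebraic), `Algebra ℚ₂ (Frac 𝒪)` by `IsFractionRing.lift`, `Module ℤ₂` on `Sg, H, H2` by `Module.compHom`; then
`CharIdealLambda.IntDescent.le_finrank_baseChange_characterModule_of_intDuality_decorated` (p678514: N5 duality over `R := ℤ₂`, conclusion over `A := 𝒪`,
coefficient descent `dim_{ℚ₂}(ℚ₂ ⊗_{ℤ₂} M) = f · dim_{Frac 𝒪}(Frac 𝒪 ⊗_𝒪 M)`) and the entry `cmLambdaLower_of_finrank_characterModule` (p666435).

* `exists_addEquiv_padicInt_pi` — an additive `ℤ₂`-basis `B : (Fin f → ℤ_p) ≃+ 𝒪` with `B (z • c) = ι z · B c` (from the unit ball, free of finite rank).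
* **`cmLambdaLower_of_intDualityData`** — conclusion = text of RSL_g VERBATIM.

References: [Kobayashi2003] Thm. 7.3 ((7.21), p. 13); [BurungaleTian2026] Thm. 2.6; [GreenbergVatsal2000] §2; [Washington1997] §13.2; [NeukirchANT1999] Ch. II (4.8).
-/

set_option autoImplicit false
set_option linter.dupNamespace false
-- the 3900-character binder blocks of the registered RSL_g signature need more than the default budget to elaborate (as in p666435 / p669433 / p673478)
set_option maxHeartbeats 1600000

noncomputable section

open scoped Classical TensorProduct

namespace Summit.BirchSwinnertonDyer.BirchSwinnertonDyer.Theorems.LambdaLowerBoundO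

open Summit.BirchSwinnertonDyer.BirchSwinnertonDyer.Theorems
open Literature.NumberTheory.EllipticCurves Literature.NumberTheory.EllipticCurves.GreenbergSelmer Literature.NumberTheory.Automorphic
open Literature.NumberTheory.GaloisRepresentations NumberField IsDedekindDomain Field
open Literature.NumberTheory.EllipticCurves GreenbergSelmer GreenbergVatsal2000 Kobayashi2003 ModularForms Rank1Residual Literature.NumberTheory.GaloisRepresentations Literature.NumberTheory.Automorphic IsDedekindDomain NumberField Field Rat.HeightOneSpectrum PowerSeries

/-! ## §1 An additive `ℤ_p`-basis of `𝒪 = padicCoeffIntegers S` -/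

/-- **`𝒪 ≅ ℤ_p^f` additively and `ℤ_p`-semilinearly** (`𝒪` is free of finite rank over `ℤ_p` for `ℚ_p(S)/ℚ_p` finite: the unit ball is,
`PadicIntermediateField.moduleFree_unitBall` / `moduleFinite_unitBall`, transported along `padicCoeffIntegers_eq_unitBall`). Stated WITHOUT an
`Algebra ℤ_p 𝒪` instance: `B (z • c) = padicIntToCoeffIntegers S z * B c`. [cite: NeukirchANT1999, Ch. II (4.8) and (6.8)] -/
theorem exists_addEquiv_padicInt_pi {p : ℕ} [Fact p.Prime] (S : Set (PadicAlgCl p)) [FiniteDimensional ℚ_[p] (padicCoeffField S)] :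
    ∃ (f : ℕ) (B : (Fin f → ℤ_[p]) ≃+ ↥(padicCoeffIntegers S)), ∀ (z : ℤ_[p]) (c : Fin f → ℤ_[p]), B (z • c) = padicIntToCoeffIntegers S z * B c := by
  set e : ↥(padicCoeffIntegers S) ≃+* ↥(PadicIntermediateField.unitBall p (padicCoeffField S)) :=
    RingEquiv.subringCongr (padicCoeffIntegers_eq_unitBall S) with he
  let U := ↥(PadicIntermediateField.unitBall p (padicCoeffField S))
  haveI : Module.Free ℤ_[p] U := inferInstance
  haveI : Module.Finite ℤ_[p] U := inferInstance
  let b := Module.finBasis ℤ_[p] U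
  refine ⟨Module.finrank ℤ_[p] U, (b.equivFun.symm.toAddEquiv).trans e.symm.toAddEquiv, fun z c => ?_⟩
  change e.symm (b.equivFun.symm (z • c)) = padicIntToCoeffIntegers S z * e.symm (b.equivFun.symm c)
  rw [map_smul, Algebra.smul_def, map_mul, ← ThetaTransport.subringCongr_padicIntToCoeffIntegers S z]
  change e.symm (e (padicIntToCoeffIntegers S z)) * _ = _
  rw [RingEquiv.symm_apply_apply]

/-! ## §2 The abstract mixed-currency bound -/

/-- **`m ≤ λ_𝒪(Sel⋆)` from a duality datum in mixed ℤ_p/𝒪-currency** (the algebra behind `cmLambdaLower_of_intDualityData`): compact side `P`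
over `ℤ_p` with `pair : P →+ Sel⋆`, `locd : H →+ P` additive and `ℤ_p`-compatible through `ι = padicIntToCoeffIntegers S` (`𝒪` acting on
`Sel, H, H2`), (EH_Z)/(ORTH)/(DH), the compact count `f·(m + e) ≤ dim_{ℚ_p}(ℚ_p ⊗_{ℤ_p} P ⧸ span(locd Z))` with `f = rank_{ℤ_p} 𝒪` witnessed by an
additive basis `B`, and the flanks in `Frac 𝒪`-currency. Proof: `ι.toAlgebra`, `Module.compHom`, `IsFractionRing.lift : ℚ_p → Frac 𝒪`, then
`CharIdealLambda.IntDescent.le_finrank_baseChange_characterModule_of_intDuality_decorated` + the coefficient descent (G1) for the three `𝒪`-modules.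
[cite: Kobayashi2003, Thm. 7.3 ((7.21), p. 13)] [cite: MilneADT2006, Ch. I, Thm. 4.10] [cite: Washington1997, §13.2] -/
theorem le_finrank_characterModule_of_intDualityData {p : ℕ} [Fact p.Prime] (S : Set (PadicAlgCl p))
    [FiniteDimensional ℚ_[p] (padicCoeffField S)]
    {Sel : Type} [AddCommGroup Sel] [Module ↥(padicCoeffIntegers S) Sel]
    [Module.Finite (FractionRing ↥(padicCoeffIntegers S)) (TensorProduct ↥(padicCoeffIntegers S) (FractionRing ↥(padicCoeffIntegers S)) (CharacterModule Sel))]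
    (P : Type) [AddCommGroup P] [Module ℤ_[p] P] (H : Type) [AddCommGroup H] [Module ↥(padicCoeffIntegers S) H]
    (H2 : Type) [AddCommGroup H2] [Module ↥(padicCoeffIntegers S) H2]
    (pair : P →+ CharacterModule Sel) (locd : H →+ P) (Z : Submodule ↥(padicCoeffIntegers S) H) (Sel₀ : Submodule ↥(padicCoeffIntegers S) Sel)
    (e f : ℕ) (B : (Fin f → ℤ_[p]) ≃+ ↥(padicCoeffIntegers S))
    (hB : ∀ (z : ℤ_[p]) (c : Fin f → ℤ_[p]), B (z • c) = padicIntToCoeffIntegers S z * B c)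
    (hpair : ∀ (z : ℤ_[p]) (t : P) (s : Sel), pair (z • t) s = pair t (padicIntToCoeffIntegers S z • s))
    (hlocd : ∀ (z : ℤ_[p]) (x : H), locd (padicIntToCoeffIntegers S z • x) = z • locd x)
    (hEH : ∀ x ∈ Z, pair (locd x) = 0) (horth : ∀ s ∈ Sel₀, ∀ t : P, pair t s = 0)
    (hDH : ∀ t : P, pair t = 0 → ∃ a : ℤ_[p], a ≠ 0 ∧ ∃ x : H, a • t = locd x)
    (hfinH : Module.Finite (FractionRing ↥(padicCoeffIntegers S))
      (TensorProduct ↥(padicCoeffIntegers S) (FractionRing ↥(padicCoeffIntegers S)) (H ⧸ Z)))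
    (hfinP : Module.Finite ℚ_[p] (TensorProduct ℤ_[p] ℚ_[p] (P ⧸ Submodule.span ℤ_[p] (locd '' (Z : Set H)))))
    {m : ℕ} (hi : f * (m + e) ≤ Module.finrank ℚ_[p] (TensorProduct ℤ_[p] ℚ_[p] (P ⧸ Submodule.span ℤ_[p] (locd '' (Z : Set H)))))
    (hii : Module.finrank (FractionRing ↥(padicCoeffIntegers S))
        (TensorProduct ↥(padicCoeffIntegers S) (FractionRing ↥(padicCoeffIntegers S)) (H ⧸ Z)) ≤
      Module.finrank (FractionRing ↥(padicCoeffIntegers S))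
        (TensorProduct ↥(padicCoeffIntegers S) (FractionRing ↥(padicCoeffIntegers S)) H2) + e)
    (hPT : Module.finrank (FractionRing ↥(padicCoeffIntegers S))
        (TensorProduct ↥(padicCoeffIntegers S) (FractionRing ↥(padicCoeffIntegers S)) H2) ≤
      Module.finrank (FractionRing ↥(padicCoeffIntegers S))
        (TensorProduct ↥(padicCoeffIntegers S) (FractionRing ↥(padicCoeffIntegers S)) (CharacterModule ↥Sel₀))) :
    m ≤ Module.finrank (FractionRing ↥(padicCoeffIntegers S))
      (TensorProduct ↥(padicCoeffIntegers S) (FractionRing ↥(padicCoeffIntegers S)) (CharacterModule Sel)) := by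
  -- the `ℤ_p`-algebra structure of `𝒪` through `ι` (local; the crux carries none)
  letI ialg : Algebra ℤ_[p] ↥(padicCoeffIntegers S) := (padicIntToCoeffIntegers S).toAlgebra
  have halg : ∀ z : ℤ_[p], algebraMap ℤ_[p] ↥(padicCoeffIntegers S) z = padicIntToCoeffIntegers S z := fun _ ↦ rfl
  have hinj : Function.Injective (padicIntToCoeffIntegers S) := fun a b h ↦ by
    have h' := congrArg (fun x : ↥(padicCoeffIntegers S) ↦ (x : PadicAlgCl p)) h
    simp only [coe_padicIntToCoeffIntegers] at h'
    exact Subtype.ext ((algebraMap ℚ_[p] (PadicAlgCl p)).injective h')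
  haveI : FaithfulSMul ℤ_[p] ↥(padicCoeffIntegers S) := (faithfulSMul_iff_algebraMap_injective ℤ_[p] _).2 hinj
  -- `𝒪` is free of rank `f` over `ℤ_p`
  let Bₗ : (Fin f → ℤ_[p]) ≃ₗ[ℤ_[p]] ↥(padicCoeffIntegers S) :=
    { B with map_smul' := fun z c ↦ by rw [AddEquiv.toFun_eq_coe, hB, RingHom.id_apply, Algebra.smul_def, halg] }
  haveI : Module.Free ℤ_[p] ↥(padicCoeffIntegers S) := Module.Free.of_equiv Bₗ
  haveI : Module.Finite ℤ_[p] ↥(padicCoeffIntegers S) := Module.Finite.equiv Bₗ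
  have hf : Module.finrank ℤ_[p] ↥(padicCoeffIntegers S) = f := by rw [← Bₗ.finrank_eq, Module.finrank_fin_fun]
  haveI : Algebra.IsAlgebraic ℤ_[p] ↥(padicCoeffIntegers S) := Algebra.IsAlgebraic.of_finite ℤ_[p] _
  -- `ℚ_p → Frac 𝒪`
  set Kf := FractionRing ↥(padicCoeffIntegers S) with hKf
  have hinjK : Function.Injective (algebraMap ℤ_[p] Kf) := by
    rw [IsScalarTower.algebraMap_eq ℤ_[p] ↥(padicCoeffIntegers S) Kf]
    exact (IsFractionRing.injective ↥(padicCoeffIntegers S) Kf).comp hinj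
  letI : Algebra ℚ_[p] Kf := (IsFractionRing.lift hinjK : ℚ_[p] →+* Kf).toAlgebra
  haveI : IsScalarTower ℤ_[p] ℚ_[p] Kf :=
    IsScalarTower.of_algebraMap_eq fun z ↦ (IsFractionRing.lift_algebraMap hinjK z).symm
  haveI : FiniteDimensional ℚ_[p] Kf :=
    CharIdealLambda.IntDescent.finiteDimensional_fractionField (R := ℤ_[p]) (A := ↥(padicCoeffIntegers S)) ℚ_[p] Kf
  have hfK : Module.finrank ℚ_[p] Kf = f := by
    rw [CharIdealLambda.IntDescent.finrank_fractionField_eq_finrank (R := ℤ_[p]) (A := ↥(padicCoeffIntegers S)) ℚ_[p] Kf, hf]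
  -- `ℤ_p`-structures on the `𝒪`-modules by restriction
  letI iSel : Module ℤ_[p] Sel := Module.compHom Sel (padicIntToCoeffIntegers S)
  haveI : IsScalarTower ℤ_[p] ↥(padicCoeffIntegers S) Sel := ⟨fun z a s ↦ mul_smul (padicIntToCoeffIntegers S z) a s⟩
  letI iH : Module ℤ_[p] H := Module.compHom H (padicIntToCoeffIntegers S)
  haveI : IsScalarTower ℤ_[p] ↥(padicCoeffIntegers S) H := ⟨fun z a s ↦ mul_smul (padicIntToCoeffIntegers S z) a s⟩
  letI iH2 : Module ℤ_[p] H2 := Module.compHom H2 (padicIntToCoeffIntegers S)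
  haveI : IsScalarTower ℤ_[p] ↥(padicCoeffIntegers S) H2 := ⟨fun z a s ↦ mul_smul (padicIntToCoeffIntegers S z) a s⟩
  letI iSel₀ : Module ℤ_[p] ↥Sel₀ := Module.compHom ↥Sel₀ (padicIntToCoeffIntegers S)
  haveI : IsScalarTower ℤ_[p] ↥(padicCoeffIntegers S) ↥Sel₀ := ⟨fun z a s ↦ mul_smul (padicIntToCoeffIntegers S z) a s⟩
  -- linear upgrades of `pair`, `locd`
  let pairₗ : P →ₗ[ℤ_[p]] CharacterModule Sel :=
    { pair with
      map_smul' := fun z t ↦ by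
        refine CharacterModule.ext _ fun s ↦ ?_
        rw [AddMonoidHom.toFun_eq_coe, RingHom.id_apply, CharacterModule.smul_apply, hpair]
        rfl }
  have hpairₗ : ∀ t, pairₗ t = pair t := fun _ ↦ rfl
  let locdₗ : H →ₗ[ℤ_[p]] P :=
    { locd with
      map_smul' := fun z x ↦ by
        rw [AddMonoidHom.toFun_eq_coe, RingHom.id_apply, ← hlocd]
        rfl }
  have hlocdₗ : ∀ x, locdₗ x = locd x := fun _ ↦ rfl
  set Zr : Submodule ℤ_[p] H := Z.restrictScalars ℤ_[p] with hZr
  set Sel₀r : Submodule ℤ_[p] Sel := Sel₀.restrictScalars ℤ_[p] with hSel₀r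
  have hmap : Zr.map locdₗ = Submodule.span ℤ_[p] (locd '' (Z : Set H)) := by
    refine le_antisymm ?_ (Submodule.span_le.mpr ?_)
    · rintro _ ⟨x, hx, rfl⟩
      exact Submodule.subset_span ⟨x, hx, rfl⟩
    · rintro _ ⟨x, hx, rfl⟩
      exact ⟨x, hx, rfl⟩
  -- the hypotheses of the `ℤ_p`-descent cut
  have hEH' : ∀ z ∈ Zr, pairₗ (locdₗ z) = 0 := fun z hz ↦ hEH z hz
  have horth' : ∀ s ∈ Sel₀r, ∀ t : P, pairₗ t s = 0 := fun s hs t ↦ horth s hs t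
  have hDH' : ∀ t : P, pairₗ t = 0 → ∃ a : ℤ_[p], a ≠ 0 ∧ ∃ x : H, a • t = locdₗ x := fun t ht ↦ hDH t ht
  haveI : Module.Finite ℚ_[p] (TensorProduct ℤ_[p] ℚ_[p] (H ⧸ Zr)) := by
    rw [hZr, CharIdealLambda.finite_baseChange_quotient_restrictScalars_iff ℚ_[p] Z,
      CharIdealLambda.IntDescent.finite_baseChange_iff (R := ℤ_[p]) (A := ↥(padicCoeffIntegers S)) ℚ_[p] Kf (M := H ⧸ Z)]
    exact hfinH
  haveI : Module.Finite ℚ_[p] (TensorProduct ℤ_[p] ℚ_[p] (P ⧸ Zr.map locdₗ)) := by rw [hmap]; exact hfinP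
  have hi' : Module.finrank ℚ_[p] Kf * m + f * e ≤ Module.finrank ℚ_[p] (TensorProduct ℤ_[p] ℚ_[p] (P ⧸ Zr.map locdₗ)) := by
    rw [hmap, hfK, ← mul_add]
    exact hi
  have hii' : Module.finrank ℚ_[p] (TensorProduct ℤ_[p] ℚ_[p] (H ⧸ Zr)) ≤ Module.finrank ℚ_[p] (TensorProduct ℤ_[p] ℚ_[p] H2) + f * e := by
    rw [hZr, CharIdealLambda.finrank_baseChange_quotient_restrictScalars_eq ℚ_[p] Z,
      CharIdealLambda.IntDescent.finrank_baseChange_eq_mul (R := ℤ_[p]) (A := ↥(padicCoeffIntegers S)) ℚ_[p] Kf (M := H ⧸ Z),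
      CharIdealLambda.IntDescent.finrank_baseChange_eq_mul (R := ℤ_[p]) (A := ↥(padicCoeffIntegers S)) ℚ_[p] Kf (M := H2), hfK, ← mul_add]
    exact Nat.mul_le_mul_left f hii
  have hPT' : Module.finrank ℚ_[p] (TensorProduct ℤ_[p] ℚ_[p] H2) ≤ Module.finrank ℚ_[p] (TensorProduct ℤ_[p] ℚ_[p] (CharacterModule ↥Sel₀r)) := by
    haveI : IsScalarTower ℤ_[p] ↥(padicCoeffIntegers S) (CharacterModule ↥Sel₀) := CharIdealLambda.IntDescent.isScalarTower_characterModule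
    change Module.finrank ℚ_[p] (TensorProduct ℤ_[p] ℚ_[p] H2) ≤ Module.finrank ℚ_[p] (TensorProduct ℤ_[p] ℚ_[p] (CharacterModule ↥Sel₀))
    rw [CharIdealLambda.IntDescent.finrank_baseChange_eq_mul (R := ℤ_[p]) (A := ↥(padicCoeffIntegers S)) ℚ_[p] Kf (M := H2),
      CharIdealLambda.IntDescent.finrank_baseChange_eq_mul (R := ℤ_[p]) (A := ↥(padicCoeffIntegers S)) ℚ_[p] Kf (M := CharacterModule ↥Sel₀), hfK]
    exact Nat.mul_le_mul_left f hPT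
  exact CharIdealLambda.IntDescent.le_finrank_baseChange_characterModule_of_intDuality_decorated (R := ℤ_[p]) (A := ↥(padicCoeffIntegers S))
    ℚ_[p] Kf pairₗ locdₗ Zr Sel₀r hEH' horth' hDH' hi' hii' hPT'

/-! ## §3 The entry in mixed currency -/

/-- **RSL_g ⟸ ONE duality datum in mixed ℤ₂/𝒪-currency** (the `_of` entry of skeleton v2 `onepair`; see the module docstring for the datum).
Conclusion: the text of RSL_g VERBATIM. [cite: Kobayashi2003, Thm. 7.3 ((7.21), p. 13)] [cite: BurungaleTian2026, Thm. 2.6 (p. 5)]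
[cite: GreenbergVatsal2000, §2 (Cor. 2.3)] [cite: Washington1997, §13.2] -/
theorem cmLambdaLower_of_intDualityData
    (hdata :
    open Literature.NumberTheory.EllipticCurves GreenbergSelmer GreenbergVatsal2000 Kobayashi2003 ModularForms Rank1Residual Literature.NumberTheory.GaloisRepresentations Literature.NumberTheory.Automorphic IsDedekindDomain NumberField Field Rat.HeightOneSpectrum PowerSeries in ∀ (W : WeierstrassCurve ℚ) [W.IsElliptic] [W.IsGloballyMinimal], ¬ W.HasCM → W.analyticRank = 0 → GoodSS W 2 → W.frobeniusTrace 2 = 0 → W.Δ < 0 → ∀ (M : ℕ) [NeZero M] (g : CuspForm (CongruenceSubgroup.Gamma0 M) 2) (ι : coeffField g →+* PadicAlgCl 2) (Ω : ℂ), Odd M → IsNewform0 g → IsCMForm (liftToGamma1 M 2 g) → cuspCoeff g 2 = 0 → IsCohomologicalPlusPeriod g ι Ω → (∀ ℓ : ℕ, ℓ.Prime → ¬ ℓ ∣ 2 * M * W.conductorNorm ℤ → ‖embCoeff g ι ℓ - (W.frobeniusTrace ℓ : PadicAlgCl 2)‖ < 1) → ∀ (κ : ZpExtension ℚ 2) (γ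 : absoluteGaloisGroup ℚ), κ.IsCyclotomic → κ.IsTopGenerator γ → IsCyclotomicVariable 2 γ → ∀ (S₀ : Finset (HeightOneSpectrum (RingOfIntegers ℚ))), (∀ v ∈ S₀, ((2 : ℕ) : RingOfIntegers ℚ) ∉ v.asIdeal) → (∀ v, ¬ W.HasGoodReductionAt v → v ∈ S₀) → (∀ v, natGenerator v ∣ M → v ∈ S₀) → ∀ (Lp Lm : IwasawaAlgebraO (Set.range ι)) (d : ℕ), IsPollackPairK g ι Ω Lp Lm → (∀ k, ‖coeff k (iwasawaOToPowerSeries (Set.range ι) Lm)‖ ≤ ‖coeff d (iwasawaOToPowerSeries (Set.range ι) Lm)‖) → (∀ k < d, ‖coeff k (iwasawaOToPowerSeries (Set.range ι) Lm)‖ < ‖coeff d (iwasawaOToPowerSeries (Set.range ι) Lm)‖) → ∀ (n : ℕ) (ρ : FramedGaloisRep ℚ ↥(padicCoeffIntegers (Set.range ι)) 2) (Θ : ∀ v : HeightOneSpectrum (RingOfIntegers ℚ), ((2 : ℕ) : RingOfIntegers ℚ) ∈ v.asIdeal → (Cofree ρ ↥(padicCoeffField (Set.range ι)) ≃+ (Fin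 n → ↥(W.geomPrimaryTorsion 2)))), (∀ v, ¬ natGenerator v ∣ 2 * M → ρ.IsUnramifiedAt v ∧ ∃ P : Polynomial ↥(padicCoeffIntegers (Set.range ι)), P.map (padicCoeffIntegers (Set.range ι)).subtype = Polynomial.X ^ 2 - Polynomial.C (embCoeff g ι (natGenerator v)) * Polynomial.X + Polynomial.C ((natGenerator v : ℕ) : PadicAlgCl 2) ∧ ρ.HasFrobCharpolyAt v P) → (∀ v hv (δ : absoluteGaloisGroup (v.adicCompletion ℚ)) m i, Θ v hv (resGalOfEmb (closureEmb (K := ℚ) (v.adicCompletion ℚ)) δ • m) i = resGalOfEmb (closureEmb (K := ℚ) (v.adicCompletion ℚ)) δ • Θ v hv m i) → ∀ (ϖ : ↥(padicCoeffIntegers (Set.range ι))), Irreducible ϖ → ∀ (Sg : AddSubgroup (subgroupH1 κ.kerSubgroup (Cofree ρ ↥(padicCoeffField (Set.range ι))))) [Module ↥(padicCoeffIntegers (Set.range ι)) ↥Sg], (∀ (a : ↥(padicCoeffIntegers (Set.range ι))) (s : ↥Sg), ((a • s : ↥Sg) : subgroupH1 κ.kerSubgroup (Cofree ρ ↥(padicCoeffField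 (Set.range ι)))) = scalarH1 κ.kerSubgroup (Cofree ρ ↥(padicCoeffField (Set.range ι))) a s) → (∀ y : subgroupH1 κ.kerSubgroup (Cofree ρ ↥(padicCoeffField (Set.range ι))), y ∈ Sg ↔ y ∈ {y : subgroupH1 κ.kerSubgroup (Cofree ρ ↥(padicCoeffField (Set.range ι))) | y ∈ unramifiedOutside κ.kerSubgroup (Cofree ρ ↥(padicCoeffField (Set.range ι))) 2 ↑S₀ ∧ (∀ w σ, conjH1 κ.kerSubgroup (Cofree ρ ↥(padicCoeffField (Set.range ι))) σ y ∈ infKer κ.kerSubgroup (Cofree ρ ↥(padicCoeffField (Set.range ι))) w) ∧ (∀ v hv σ, ∃ (φ : _) (Q : Fin n → localPoints W (v.adicCompletion ℚ)) (k : ℕ), oneCocycleClass (discreteTopRep ↥κ.kerSubgroup (Cofree ρ ↥(padicCoeffField (Set.range ι)))) φ = conjH1 κ.kerSubgroup (Cofree ρ ↥(padicCoeffField (Set.range ι))) σ y ∧ (∀ i, (2 ^ k) • Q i ∈ ⨆ m : ℕ, signedLocalPoints κ (v.adicCompletion ℚ) W 1 m) ∧ ∀ τ i, pointsMapOfEmb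 W (closureEmb (K := ℚ) (v.adicCompletion ℚ)) (((Θ v hv (φ.1 (resGalSubgroupOfEmb κ.kerSubgroup (closureEmb (K := ℚ) (v.adicCompletion ℚ)) τ))) i : ↥(W.geomPrimaryTorsion 2)) : W.geomPoints) = (τ : absoluteGaloisGroup (v.adicCompletion ℚ)) • Q i - Q i)}) → (∀ (τ : absoluteGaloisGroup ℚ) (y : subgroupH1 κ.kerSubgroup (Cofree ρ ↥(padicCoeffField (Set.range ι)))), y ∈ Sg → conjH1 κ.kerSubgroup (Cofree ρ ↥(padicCoeffField (Set.range ι))) τ y ∈ Sg) → ({y : subgroupH1 κ.kerSubgroup (Cofree ρ ↥(padicCoeffField (Set.range ι))) | y ∈ unramifiedOutside κ.kerSubgroup (Cofree ρ ↥(padicCoeffField (Set.range ι))) 2 ↑S₀ ∧ (∀ w σ, conjH1 κ.kerSubgroup (Cofree ρ ↥(padicCoeffField (Set.range ι))) σ y ∈ infKer κ.kerSubgroup (Cofree ρ ↥(padicCoeffField (Set.range ι))) w) ∧ (∀ v hv σ, ∃ (φ : _) (Q : Fin n → localPoints W (v.adicCompletion ℚ)) (k : ℕ), oneCocycleClass (discreteTopRep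 ↥κ.kerSubgroup (Cofree ρ ↥(padicCoeffField (Set.range ι)))) φ = conjH1 κ.kerSubgroup (Cofree ρ ↥(padicCoeffField (Set.range ι))) σ y ∧ (∀ i, (2 ^ k) • Q i ∈ ⨆ m : ℕ, signedLocalPoints κ (v.adicCompletion ℚ) W 1 m) ∧ ∀ τ i, pointsMapOfEmb W (closureEmb (K := ℚ) (v.adicCompletion ℚ)) (((Θ v hv (φ.1 (resGalSubgroupOfEmb κ.kerSubgroup (closureEmb (K := ℚ) (v.adicCompletion ℚ)) τ))) i : ↥(W.geomPrimaryTorsion 2)) : W.geomPoints) = (τ : absoluteGaloisGroup (v.adicCompletion ℚ)) • Q i - Q i) ∧ scalarH1 κ.kerSubgroup (Cofree ρ ↥(padicCoeffField (Set.range ι))) ϖ y = 0} : Set _).Finite → ∃ (P : Type) (_ : AddCommGroup P) (_ : Module ℤ_[2] P) (H : Type) (_ : AddCommGroup H) (_ : Module ↥(padicCoeffIntegers (Set.range ι)) H) (H2 : Type) (_ : AddCommGroup H2) (_ : Module ↥(padicCoeffIntegers (Set.range ι)) H2) (pair : P →+ CharacterModule ↥Sg) (locd : H →+ P) (Z : Submodule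 ↥(padicCoeffIntegers (Set.range ι)) H) (Sel₀ : Submodule ↥(padicCoeffIntegers (Set.range ι)) ↥Sg) (e f : ℕ) (B : (Fin f → ℤ_[2]) ≃+ ↥(padicCoeffIntegers (Set.range ι))), (∀ (z : ℤ_[2]) (c : Fin f → ℤ_[2]), B (z • c) = padicIntToCoeffIntegers (Set.range ι) z * B c) ∧ (∀ (z : ℤ_[2]) (t : P) (s : ↥Sg), pair (z • t) s = pair t (padicIntToCoeffIntegers (Set.range ι) z • s)) ∧ (∀ (z : ℤ_[2]) (x : H), locd (padicIntToCoeffIntegers (Set.range ι) z • x) = z • locd x) ∧ (∀ x ∈ Z, pair (locd x) = 0) ∧ (∀ s ∈ Sel₀, ∀ t : P, pair t s = 0) ∧ (∀ t : P, pair t = 0 → ∃ a : ℤ_[2], a ≠ 0 ∧ ∃ x : H, a • t = locd x) ∧ Module.Finite (FractionRing ↥(padicCoeffIntegers (Set.range ι))) (TensorProduct ↥(padicCoeffIntegers (Set.range ι)) (FractionRing ↥(padicCoeffIntegers (Set.range ι))) (H ⧸ Z)) ∧ Module.Finite ℚ_[2] (TensorProduct ℤ_[2] ℚ_[2] (P ⧸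 Submodule.span ℤ_[2] (locd '' (Z : Set H)))) ∧ f * (d + (∑ v ∈ S₀, 2 ^ padicValNat 2 ((natGenerator v ^ 2 - 1) / 8) * (if natGenerator v ∣ M then (if ‖embCoeff g ι (natGenerator v) - 1‖ < 1 then 1 else 0) else (if ‖embCoeff g ι (natGenerator v)‖ < 1 then 2 else 0))) + e) ≤ Module.finrank ℚ_[2] (TensorProduct ℤ_[2] ℚ_[2] (P ⧸ Submodule.span ℤ_[2] (locd '' (Z : Set H)))) ∧ Module.finrank (FractionRing ↥(padicCoeffIntegers (Set.range ι))) (TensorProduct ↥(padicCoeffIntegers (Set.range ι)) (FractionRing ↥(padicCoeffIntegers (Set.range ι))) (H ⧸ Z)) ≤ Module.finrank (FractionRing ↥(padicCoeffIntegers (Set.range ι))) (TensorProduct ↥(padicCoeffIntegers (Set.range ι)) (FractionRing ↥(padicCoeffIntegers (Set.range ι))) H2) + e ∧ Module.finrank (FractionRing ↥(padicCoeffIntegers (Set.range ι))) (TensorProduct ↥(padicCoeffIntegers (Set.range ι)) (FractionRing ↥(padicCoeffIntegers (Set.range ι))) H2) ≤ Module.finrank (FractionRing ↥(padicCoeffIntegers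 (Set.range ι))) (TensorProduct ↥(padicCoeffIntegers (Set.range ι)) (FractionRing ↥(padicCoeffIntegers (Set.range ι))) (CharacterModule ↥Sel₀))) :
    open Literature.NumberTheory.EllipticCurves GreenbergSelmer GreenbergVatsal2000 Kobayashi2003 ModularForms Rank1Residual Literature.NumberTheory.GaloisRepresentations Literature.NumberTheory.Automorphic IsDedekindDomain NumberField Field Rat.HeightOneSpectrum PowerSeries in ∀ (W : WeierstrassCurve ℚ) [W.IsElliptic] [W.IsGloballyMinimal], ¬ W.HasCM → W.analyticRank = 0 → GoodSS W 2 → W.frobeniusTrace 2 = 0 → W.Δ < 0 → ∀ (M : ℕ) [NeZero M] (g : CuspForm (CongruenceSubgroup.Gamma0 M) 2) (ι : coeffField g →+* PadicAlgCl 2) (Ω : ℂ), Odd M → IsNewform0 g → IsCMForm (liftToGamma1 M 2 g) → cuspCoeff g 2 = 0 → IsCohomologicalPlusPeriod g ι Ω → (∀ ℓ : ℕ, ℓ.Prime → ¬ ℓ ∣ 2 * M * W.conductorNorm ℤ → ‖embCoeff g ι ℓ - (W.frobeniusTrace ℓ : PadicAlgCl 2)‖ < 1) → ∀ (κ : ZpExtension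 ℚ 2) (γ : absoluteGaloisGroup ℚ), κ.IsCyclotomic → κ.IsTopGenerator γ → IsCyclotomicVariable 2 γ → ∀ (S₀ : Finset (HeightOneSpectrum (RingOfIntegers ℚ))), (∀ v ∈ S₀, ((2 : ℕ) : RingOfIntegers ℚ) ∉ v.asIdeal) → (∀ v, ¬ W.HasGoodReductionAt v → v ∈ S₀) → (∀ v, natGenerator v ∣ M → v ∈ S₀) → ∀ (Lp Lm : IwasawaAlgebraO (Set.range ι)) (d : ℕ), IsPollackPairK g ι Ω Lp Lm → (∀ k, ‖coeff k (iwasawaOToPowerSeries (Set.range ι) Lm)‖ ≤ ‖coeff d (iwasawaOToPowerSeries (Set.range ι) Lm)‖) → (∀ k < d, ‖coeff k (iwasawaOToPowerSeries (Set.range ι) Lm)‖ < ‖coeff d (iwasawaOToPowerSeries (Set.range ι) Lm)‖) → ∀ (n : ℕ) (ρ : FramedGaloisRep ℚ ↥(padicCoeffIntegers (Set.range ι)) 2) (Θ : ∀ v : HeightOneSpectrum (RingOfIntegers ℚ), ((2 : ℕ) : RingOfIntegers ℚ) ∈ v.asIdeal → (Cofree ρ ↥(padicCoeffField (Set.range ι))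 ≃+ (Fin n → ↥(W.geomPrimaryTorsion 2)))), (∀ v, ¬ natGenerator v ∣ 2 * M → ρ.IsUnramifiedAt v ∧ ∃ P : Polynomial ↥(padicCoeffIntegers (Set.range ι)), P.map (padicCoeffIntegers (Set.range ι)).subtype = Polynomial.X ^ 2 - Polynomial.C (embCoeff g ι (natGenerator v)) * Polynomial.X + Polynomial.C ((natGenerator v : ℕ) : PadicAlgCl 2) ∧ ρ.HasFrobCharpolyAt v P) → (∀ v hv (δ : absoluteGaloisGroup (v.adicCompletion ℚ)) m i, Θ v hv (resGalOfEmb (closureEmb (K := ℚ) (v.adicCompletion ℚ)) δ • m) i = resGalOfEmb (closureEmb (K := ℚ) (v.adicCompletion ℚ)) δ • Θ v hv m i) → ∀ (ϖ : ↥(padicCoeffIntegers (Set.range ι))), Irreducible ϖ → ((Nat.card (↥(padicCoeffIntegers (Set.range ι)) ⧸ Ideal.span {ϖ}) ^ (d + ∑ v ∈ S₀, 2 ^ padicValNat 2 ((natGenerator v ^ 2 - 1) / 8) * (if natGenerator v ∣ M then (if ‖embCoeff g ι (natGenerator v) - 1‖ < 1 then 1 else 0) else (if ‖embCoeff g ι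 (natGenerator v)‖ < 1 then 2 else 0))) : ℕ) : ℕ∞) ≤ {y : subgroupH1 κ.kerSubgroup (Cofree ρ ↥(padicCoeffField (Set.range ι))) | y ∈ unramifiedOutside κ.kerSubgroup (Cofree ρ ↥(padicCoeffField (Set.range ι))) 2 ↑S₀ ∧ (∀ w σ, conjH1 κ.kerSubgroup (Cofree ρ ↥(padicCoeffField (Set.range ι))) σ y ∈ infKer κ.kerSubgroup (Cofree ρ ↥(padicCoeffField (Set.range ι))) w) ∧ (∀ v hv σ, ∃ (φ : _) (Q : Fin n → localPoints W (v.adicCompletion ℚ)) (k : ℕ), oneCocycleClass (discreteTopRep ↥κ.kerSubgroup (Cofree ρ ↥(padicCoeffField (Set.range ι)))) φ = conjH1 κ.kerSubgroup (Cofree ρ ↥(padicCoeffField (Set.range ι))) σ y ∧ (∀ i, (2 ^ k) • Q i ∈ ⨆ m : ℕ, signedLocalPoints κ (v.adicCompletion ℚ) W 1 m) ∧ ∀ τ i, pointsMapOfEmb W (closureEmb (K := ℚ) (v.adicCompletion ℚ)) (((Θ v hv (φ.1 (resGalSubgroupOfEmb κ.kerSubgroup (closureEmb (K := ℚ) (v.adicCompletion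 ℚ)) τ))) i : ↥(W.geomPrimaryTorsion 2)) : W.geomPoints) = (τ : absoluteGaloisGroup (v.adicCompletion ℚ)) • Q i - Q i) ∧ scalarH1 κ.kerSubgroup (Cofree ρ ↥(padicCoeffField (Set.range ι))) ϖ y = 0}.encard := by
  refine cmLambdaLower_of_finrank_characterModule ?_
  intro W _ _ hCM hr0 hss ha2 hΔ M _ g ι Ω hM hnew hcmf ha2g hΩ hcong κ γ hκ hγ hcyc S₀ hS₀ hbad hMS Lp Lm d hpair
    hle hlt n ρ Θ hρ hΘ ϖ hϖ Sg inst hsmul hmem hconj hfin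
  haveI : FiniteDimensional ℚ (ModularForms.coeffField g) :=
    ModularForms.IsNewform0.finiteDimensional_coeffField_holds hnew
  haveI : FiniteDimensional ℚ_[2] ↥(padicCoeffField (Set.range ι)) :=
    GreenbergSelmer.finiteDimensional_padicCoeffField ι
  haveI : IsDiscreteValuationRing ↥(padicCoeffIntegers (Set.range ι)) :=
    PollackPairK.isDiscreteValuationRing_padicCoeffIntegers
  -- «μ = 0 for free»: `Sg⋆` is finitely generated over `𝒪`, hence `K ⊗ Sg⋆` is finite-dimensional (p665052)
  have hfin' : {c : subgroupH1 κ.kerSubgroup (Cofree ρ ↥(padicCoeffField (Set.range ι))) |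
      c ∈ Sg ∧ scalarH1 κ.kerSubgroup (Cofree ρ ↥(padicCoeffField (Set.range ι))) ϖ c = 0}.Finite :=
    hfin.subset fun y hy ↦
      ⟨((hmem y).1 hy.1).1, ((hmem y).1 hy.1).2.1, ((hmem y).1 hy.1).2.2, hy.2⟩
  haveI : Module.Finite ↥(padicCoeffIntegers (Set.range ι)) (CharacterModule ↥Sg) :=
    module_finite_characterModule_of_finite_scalarH1_torsion (Set.range ι) κ ρ Sg hsmul hϖ hfin'
  haveI : Module.Finite (FractionRing ↥(padicCoeffIntegers (Set.range ι)))
      (TensorProduct ↥(padicCoeffIntegers (Set.range ι)) (FractionRing ↥(padicCoeffIntegers (Set.range ι))) (CharacterModule ↥Sg)) :=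
    inferInstance
  -- the datum (`Exists.elim` chains, no pattern matching against the large goal)
  refine (hdata W hCM hr0 hss ha2 hΔ M g ι Ω hM hnew hcmf ha2g hΩ hcong κ γ hκ hγ hcyc S₀ hS₀ hbad hMS Lp Lm d hpair
    hle hlt n ρ Θ hρ hΘ ϖ hϖ Sg hsmul hmem hconj hfin).elim fun P h5 ↦ ?_
  refine h5.elim fun _ h6 ↦ h6.elim fun _ h7 ↦ h7.elim fun H h8 ↦ h8.elim fun _ h9 ↦ h9.elim fun _ h10 ↦ ?_
  refine h10.elim fun H2 h11 ↦ h11.elim fun _ h12 ↦ h12.elim fun _ h13 ↦ h13.elim fun pair h14 ↦ h14.elim fun locd h15 ↦ ?_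
  refine h15.elim fun Z h16 ↦ h16.elim fun Sel₀ h17 ↦ h17.elim fun e h18 ↦ h18.elim fun f h19 ↦ h19.elim fun B h20 ↦ ?_
  obtain ⟨hB, hpairz, hlocdz, hEH, hORTH, hDH, hfinH, hfinP, hi, hii, hPT⟩ := h20
  exact le_finrank_characterModule_of_intDualityData (Set.range ι) P H H2 pair locd Z Sel₀ e f B hB hpairz hlocdz hEH hORTH hDH hfinH hfinP hi hii hPT

end Summit.BirchSwinnertonDyer.BirchSwinnertonDyer.Theorems.LambdaLowerBoundO

end
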